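import Summits.HodgeConjecture.CorCM.MumfordTateRankRibetTypeOnePairsRigid
import Summits.HodgeConjecture.CorCM.MumfordTateRankRigidModuloCentre
import HarnessLib

/-!
# Two Ribet-type abelian varieties with NON-ISOMORPHIC fields: `H¹(A × A′)` is `Θ`-rigid in EVERY pair of dimensions `g, g′ ≥ 3`
# (including `g = g′`), hence `t((A × A′) × Y) ≥ t(A × A′) = g² + g′² + 1` for every `Y` — rigidity modulo the centre + the trace test

COR-CM (cell `pub-hodgecm2`, seat `b27` gen 54, count-neutral Mumford–Tate-rank ladder; theorems only, no definition, no named fact; UNCONDITIONAL —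
nothing here uses or asserts HC_CM).  Gen 53 (`CorCM/MumfordTateRankRibetTypeOnePairsRigid`) proved the `Θ`-rigidity of `H¹(A × A′)` for
Ribet types `(g−1,1)`, `(g′−1,1)` with `g ≠ g′` by COUNTING (to put the derived corners into a `Θ`-subalgebra `𝔞`), leaving `g = g′` open.
With gen 54ʼs «rigidity modulo the centre» (`Motives/HodgeLieRigidModuloCentre.derived_le_of_theta_mem`: EVERY `Θ`-subalgebra contains
`[𝔥, 𝔥]`) the counting disappears: for `End⁰A ≇ End⁰A′`, `𝔞 ⊇ [𝔥, 𝔥]` and `Θ ∈ 𝔞 ⊗ ℂ` feed gen 53ʼs trace test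
(`UnitaryPair.incl_phi_proj_mem_of_subalgebra_of_nonresonant`: `tr(Θ_{A_i} φ_i^*) = ±2(g_i − 2) i√d_i`, `d₁/d₂ ∉ (ℚ^×)²`), which puts both central
generators `ι_iφ_i^*π_i` into `𝔞`; since the skew centre of `𝔥` lies on `ℚ ι₁φ₁^*π₁ ⊕ ℚ ι₂φ₂^*π₂` and `𝔥 = 𝔷 ⊕ [𝔥,𝔥]` (Deligne), `𝔞 = 𝔥`.
* **`hodgeLie_rigid_prod_ribetTypeOne_of_isEmpty_ringHom`** — `H¹(A × A′)` is `Θ`-rigid (any `g, g′ ≥ 3`, fields non-isomorphic);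
* **`mtRank_hodge_one_le_of_isIsogenous_prod_ribetTypeOne_prod_of_isEmpty_ringHom`** — `t(X) ≥ t(A × A′)` for `X ∼ (A × A′) × Y`.
The same-field case with `g = g′`, `A ≁ A′` remains (the one-dimensional centre must be located against `Θ`, `Motives/HodgeLieRigidityTraceCriterion`).

## References
* [MoonenZarhin1999LowDim] B. Moonen, Yu. G. Zarhin, *Hodge classes on abelian varieties of low dimension*, Math. Ann. 315 (1999), §3 (3.1), Lemma (3.4)
  [corpus: paper:arxiv-math_9901113 p. 6]. [cite: MoonenZarhin1999LowDim, §3 (3.1) and Lemma (3.4)]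
* [Deligne1982HodgeCycles] P. Deligne, LNM 900 (1982), I §3 Prop. 3.6. [cite: Deligne1982HodgeCycles, I §3 Prop. 3.6]
* [Ribet1983] K. A. Ribet, Amer. J. Math. 105 (1983), Thm. 3. [cite: Ribet1983, Thm. 3]
* [Gordon1997] B. B. Gordon, *A survey of the Hodge conjecture for abelian varieties*, 1.13.2. [cite: Gordon1997, 1.13.2]
-/

noncomputable section

open scoped TensorProduct
open CategoryTheory CategoryTheory.Limits Module NumberField

namespace Summit.HodgeConjecture.CorCM

open Literature.AlgebraicGeometry.Motives
open Literature.AlgebraicGeometry.Motives.AbelianVariety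
open Literature.AlgebraicGeometry.Motives.HodgeStructure
open Literature.AlgebraicGeometry.HodgeTheory
open Literature.AlgebraicGeometry.ComplexMultiplication

variable [HodgeTensorFacts.{0, 0}] {X : AbelianVariety ℂ} {n : ℕ}

set_option maxHeartbeats 1600000 in
/-- **`H¹(A × A′)` is `Θ`-rigid for `A`, `A′` of Ribet types `(g−1,1)`, `(g′−1,1)` (`g, g′ ≥ 3`) with NON-ISOMORPHIC fields `End⁰A ≇ End⁰A′`**
(no ring homomorphism `End⁰A′ → End⁰A`): every bracket-closed rational `𝔞 ⊆ Lie Hg(H¹(A × A′))` whose complex span contains a Hodge operator is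
everything — `[𝔥,𝔥] ⊆ 𝔞` (rigidity modulo the centre), the trace test puts `ι₁φ₁^*π₁, ι₂φ₂^*π₂ ∈ 𝔞`, and the skew centre lies on their span.
[cite: MoonenZarhin1999LowDim, §3 (3.1) and Lemma (3.4)] [cite: Deligne1982HodgeCycles, I §3 Prop. 3.6] [cite: Gordon1997, 1.13.2] -/
theorem hodgeLie_rigid_prod_ribetTypeOne_of_isEmpty_ringHom {A A' : AbelianVariety ℂ} {m : ℕ} (hP : IsSmoothProjective m (A.prod A').X)
    (φ : A ⟶ A) {d : ℕ} (hd : 0 < d) (hφ : φ ≫ φ = -(d • 𝟙 A)) (hAE : Module.finrank ℚ A.endAlgebra = 2)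
    (h1 : eigenMultiplicity A φ (Complex.I * (Real.sqrt d : ℂ)) = 1 ∨ eigenMultiplicity A φ (-(Complex.I * (Real.sqrt d : ℂ))) = 1) (hdim : 3 ≤ A.dim)
    (φ' : A' ⟶ A') {d' : ℕ} (hd' : 0 < d') (hφ' : φ' ≫ φ' = -(d' • 𝟙 A')) (hA'E : Module.finrank ℚ A'.endAlgebra = 2)
    (h1' : eigenMultiplicity A' φ' (Complex.I * (Real.sqrt d' : ℂ)) = 1 ∨ eigenMultiplicity A' φ' (-(Complex.I * (Real.sqrt d' : ℂ))) = 1)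
    (hdim' : 3 ≤ A'.dim) (hfor : IsEmpty (A'.endAlgebra →+* A.endAlgebra)) :
    haveI := BettiUniverse.finite hP 1
    ∀ 𝔞 : Submodule ℚ (Module.End ℚ (bettiCohomology (A.prod A').X 1)),
      𝔞 ≤ (BettiUniverse.hodge exists_isReal_hodgeModel_holds hP 1).hodgeLie →
      (∀ B ∈ 𝔞, ∀ B' ∈ 𝔞, B * B' - B' * B ∈ 𝔞) →
      (∃ Θ ∈ Submodule.span ℂ ((fun B : Module.End ℚ (bettiCohomology (A.prod A').X 1) => B.baseChange ℂ) ''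
          (𝔞 : Set (Module.End ℚ (bettiCohomology (A.prod A').X 1)))),
        ∀ p, ∀ x ∈ (BettiUniverse.hodge exists_isReal_hodgeModel_holds hP 1).piece p (((1 : ℕ) : ℤ) - p),
          Θ x = ((2 * p - ((1 : ℕ) : ℤ) : ℤ) : ℂ) • x) →
      (BettiUniverse.hodge exists_isReal_hodgeModel_holds hP 1).hodgeLie ≤ 𝔞 := by
  classical
  have hnP : (A.prod A').dim = m := schemeDim_eq_holds hP
  subst hnP
  have hT : IsSmoothProjective A.dim A.X := AbelianVariety.isSmoothProjective_holds
  have hT' : IsSmoothProjective A'.dim A'.X := AbelianVariety.isSmoothProjective_holds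
  haveI := BettiUniverse.finite hP 1
  haveI := BettiUniverse.finite hT 1
  haveI := BettiUniverse.finite hT' 1
  intro 𝔞 h𝔞 hbr hΘex
  -- per-factor data
  obtain ⟨μ₁, k₁, hφ₁E, hφ₁2, hE₁, hμ₁, h1₁, h2₁, hφ₁𝔥, hZ₁, hσ₁, hk₁, hτ₁⟩ := ribetTypeOne_factor_data hT φ hd hφ hAE h1 hdim
  obtain ⟨μ₂, k₂, hφ₂E, hφ₂2, hE₂, hμ₂, h1₂, h2₂, hφ₂𝔥, hZ₂, hσ₂, hk₂, hτ₂⟩ := ribetTypeOne_factor_data hT' φ' hd' hφ' hA'E h1' hdim'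
  set φ₁ : Module.End ℚ (bettiCohomology A.X 1) := (bettiCohomology.map φ.hom.hom.hom 1).hom with hφ₁
  set φ₂ : Module.End ℚ (bettiCohomology A'.X 1) := (bettiCohomology.map φ'.hom.hom.hom 1).hom with hφ₂
  set H := BettiUniverse.hodge exists_isReal_hodgeModel_holds hP 1 with hHdef
  set H₁ := BettiUniverse.hodge exists_isReal_hodgeModel_holds hT 1 with hH₁def
  set H₂ := BettiUniverse.hodge exists_isReal_hodgeModel_holds hT' 1 with hH₂def
  obtain ⟨ψ₁⟩ := BettiUniverse.hodge_isPolarizable exists_isReal_hodgeModel_holds hT 1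
  obtain ⟨ψ₂⟩ := BettiUniverse.hodge_isPolarizable exists_isReal_hodgeModel_holds hT' 1
  obtain ⟨ψ⟩ := BettiUniverse.hodge_isPolarizable exists_isReal_hodgeModel_holds hP 1
  have hd₁Q : (0 : ℚ) < d := Nat.cast_pos.2 hd
  have hd₂Q : (0 : ℚ) < d' := Nat.cast_pos.2 hd'
  -- the bicone of `H¹(A × A')`
  let ι₁ := BettiUniverse.pullHodgeHom exists_isReal_hodgeModel_holds hodgePQ_independent_of_hodgeModel_holds hP hT (fst A A').hom.hom.hom 1
  let π₁ := BettiUniverse.pullHodgeHom exists_isReal_hodgeModel_holds hodgePQ_independent_of_hodgeModel_holds hT hP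
    (prodLift (𝟙 A) (0 : A ⟶ A')).hom.hom.hom 1
  let ι₂ := BettiUniverse.pullHodgeHom exists_isReal_hodgeModel_holds hodgePQ_independent_of_hodgeModel_holds hP hT' (snd A A').hom.hom.hom 1
  let π₂ := BettiUniverse.pullHodgeHom exists_isReal_hodgeModel_holds hodgePQ_independent_of_hodgeModel_holds hT' hP
    (prodLift (0 : A' ⟶ A) (𝟙 A')).hom.hom.hom 1
  have hsumP : fst A A' ≫ prodLift (𝟙 A) (0 : A ⟶ A') + snd A A' ≫ prodLift (0 : A' ⟶ A) (𝟙 A') = 𝟙 _ := by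
    refine prod_hom_ext ?_ ?_
    · rw [Preadditive.add_comp, Category.assoc, Category.assoc, prodLift_fst, prodLift_fst, Category.comp_id, comp_zero, add_zero, Category.id_comp]
    · rw [Preadditive.add_comp, Category.assoc, Category.assoc, prodLift_snd, prodLift_snd, Category.comp_id, comp_zero, zero_add, Category.id_comp]
  have hπι₁ : ∀ v, π₁.toLinearMap (ι₁.toLinearMap v) = v := fun v => pull_pull_eq_self_of_comp_eq_id (prodLift_fst _ _) v
  have hπι₂ : ∀ v, π₂.toLinearMap (ι₂.toLinearMap v) = v := fun v => pull_pull_eq_self_of_comp_eq_id (prodLift_snd _ _) v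
  have hsum : ∀ v, ι₁.toLinearMap (π₁.toLinearMap v) + ι₂.toLinearMap (π₂.toLinearMap v) = v := fun v =>
    pull_pull_add_pull_pull_eq_self _ _ _ _ hsumP v
  -- the skew centre of `Lie Hg(H¹(A × A'))` is on `ℚ ι₁φ₁π₁ + ℚ ι₂φ₂π₂`
  have hZ : ∀ z ∈ H.hodgeLie ⊓ Subalgebra.toSubmodule H.endAlg, ∃ x₁ x₂ : ℚ,
      z = x₁ • (ι₁.toLinearMap ∘ₗ φ₁ ∘ₗ π₁.toLinearMap) + x₂ • (ι₂.toLinearMap ∘ₗ φ₂ ∘ₗ π₂.toLinearMap) := by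
    intro z hz
    obtain ⟨hz𝔥, hzE⟩ := Submodule.mem_inf.1 hz
    rw [Subalgebra.mem_toSubmodule] at hzE
    have hb := eq_sum_blocks_of_mem_hodgeLie ι₁ π₁ ι₂ π₂ hπι₁ hπι₂ hsum hz𝔥
    obtain ⟨x₁, hx₁⟩ := hZ₁ ψ₁ _ (Submodule.mem_inf.2 ⟨comp_mem_hodgeLie_of_retract ι₁ π₁ hπι₁ hz𝔥,
      ((π₁.comp (endAlg.toHom ⟨z, hzE⟩)).comp ι₁).toLinearMap_mem_endAlg⟩)
    obtain ⟨x₂, hx₂⟩ := hZ₂ ψ₂ _ (Submodule.mem_inf.2 ⟨comp_mem_hodgeLie_of_retract ι₂ π₂ hπι₂ hz𝔥,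
      ((π₂.comp (endAlg.toHom ⟨z, hzE⟩)).comp ι₂).toLinearMap_mem_endAlg⟩)
    refine ⟨x₁, x₂, ?_⟩
    rw [hb, hx₁, hx₂]
    simp only [LinearMap.smul_comp, LinearMap.comp_smul]
  -- `[𝔥,𝔥] ⊆ 𝔞`: rigidity modulo the centre (gen 54)
  have h𝔡𝔞 : Submodule.span ℚ {B | ∃ X' ∈ H.hodgeLie, ∃ Y ∈ H.hodgeLie, X' * Y - Y * X' = B} ≤ 𝔞 :=
    derived_le_of_theta_mem H ψ 𝔞 h𝔞 hbr hΘex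
  -- different fields: the trace test puts both `ι_iφ_iπ_i` in `𝔞`
  obtain ⟨Θ, hΘ𝔞, hΘ⟩ := hΘex
  have hfree : ∀ s : ℚ, (d : ℚ) ≠ s ^ 2 * d' := forall_ne_sq_mul_of_isEmpty_ringHom hfor hA'E hd' hφ' hφ hd
  obtain ⟨hE₁𝔞, hE₂𝔞⟩ := UnitaryPair.incl_phi_proj_mem_of_subalgebra_of_nonresonant ι₁ π₁ ι₂ π₂ hπι₁ hπι₂ hsum hφ₁E hφ₂E ψ hZ hd₁Q hφ₁2 hd₂Q
    hφ₂2 hσ₁ hσ₂ hk₁ hk₂ hτ₁ hτ₂ hfree 𝔞 h𝔞 h𝔡𝔞 hΘ hΘ𝔞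
  -- `𝔥 = 𝔷 ⊕ [𝔥,𝔥] ⊆ 𝔞`
  intro Y hY
  have hdec := hodgeLie_hodge_one_center_sup_derived hP
  rw [← hdec] at hY
  obtain ⟨z, hz, e, he, rfl⟩ := Submodule.mem_sup.1 hY
  obtain ⟨x₁, x₂, rfl⟩ := hZ z hz
  exact 𝔞.add_mem (𝔞.add_mem (𝔞.smul_mem _ hE₁𝔞) (𝔞.smul_mem _ hE₂𝔞)) (h𝔡𝔞 he)

/-- **`t(X) ≥ t(A × A′) (= g² + g′² + 1)` for every `X ∼ (A × A′) × Y`**, `A`, `A′` of Ribet types `(g−1,1)`, `(g′−1,1)` with non-isomorphic fields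
(any `g, g′ ≥ 3`; rigidity above and `mtRank_hodge_one_le_of_isIsogenous_prod_of_rigid`). [cite: MoonenZarhin1999LowDim, §3 (3.1) and Lemma (3.4)]
[cite: Ribet1983, Thm. 3] -/
theorem mtRank_hodge_one_le_of_isIsogenous_prod_ribetTypeOne_prod_of_isEmpty_ringHom (hX : IsSmoothProjective n X.X)
    {A A' Y : AbelianVariety ℂ} {m : ℕ} (hP : IsSmoothProjective m (A.prod A').X)
    (φ : A ⟶ A) {d : ℕ} (hd : 0 < d) (hφ : φ ≫ φ = -(d • 𝟙 A)) (hAE : Module.finrank ℚ A.endAlgebra = 2)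
    (h1 : eigenMultiplicity A φ (Complex.I * (Real.sqrt d : ℂ)) = 1 ∨ eigenMultiplicity A φ (-(Complex.I * (Real.sqrt d : ℂ))) = 1) (hdim : 3 ≤ A.dim)
    (φ' : A' ⟶ A') {d' : ℕ} (hd' : 0 < d') (hφ' : φ' ≫ φ' = -(d' • 𝟙 A')) (hA'E : Module.finrank ℚ A'.endAlgebra = 2)
    (h1' : eigenMultiplicity A' φ' (Complex.I * (Real.sqrt d' : ℂ)) = 1 ∨ eigenMultiplicity A' φ' (-(Complex.I * (Real.sqrt d' : ℂ))) = 1)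
    (hdim' : 3 ≤ A'.dim) (hfor : IsEmpty (A'.endAlgebra →+* A.endAlgebra)) (hXP : IsIsogenous X ((A.prod A').prod Y)) :
    haveI := BettiUniverse.finite hX 1
    haveI := BettiUniverse.finite hP 1
    (BettiUniverse.hodge exists_isReal_hodgeModel_holds hP 1).mtRank ≤ (BettiUniverse.hodge exists_isReal_hodgeModel_holds hX 1).mtRank :=
  mtRank_hodge_one_le_of_isIsogenous_prod_of_rigid hX hP (by rw [dim_prod]; omega)
    (hodgeLie_rigid_prod_ribetTypeOne_of_isEmpty_ringHom hP φ hd hφ hAE h1 hdim φ' hd' hφ' hA'E h1' hdim' hfor) hXP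

end Summit.HodgeConjecture.CorCM

end
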